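import Summits.Ventures.PercRepro.ProfileGapMonoLoop
import Summits.Ventures.PercRepro.ProfileGapMonoParallel
import Summits.Ventures.PercRepro.ProfileSeriesCount

/-!
# PercRepro — THE GAP-MONOTONICITY RULE ONLY HAS TO BE CHECKED ON SIMPLE MATROIDS: the reduction theorem
(p10, gen 7; `proofs/P10-AVFULL.md` §13)

`SimpleRuleQ α` — every SIMPLE matroid on at least `u + q + 1` elements has a gap-monotone point at `(q, u)` — implies
the co-rank-`q` row `ProfileIneqMinusQ M q u` of EVERY finite matroid for every `q < u`
(`profileIneqMinusQ_of_simpleRuleQ`), hence `C025` (`c025_of_simpleRuleQ`).  The proof is a strong induction on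
`#E` for all `(q, u)` at once: `q = 0` is the basis count (`profileIneqMinusQ_zero`); a loop `ℓ` is a gap-monotone
point by `gapMonoQ_of_loop` (the row of `M ∖ ℓ` is the induction hypothesis); a parallel pair `z ∥ z'` gives the
gap-monotone point `z` by `gapMonoQ_of_parallel` (the row `(q−1, u−1)` of `(M ∖ z) ／ z'` is the induction
hypothesis); a loopless matroid without parallel pairs is simple, and the rule gives the point.  In every case the
row of `M ∖ z` (induction hypothesis) and `profileIneqMinusQ_of_gapMonoQ` close the row of `M`.

* `profileIneqMinusQ_of_loop_delete`, `profileIneqMinusQ_zero_aux`, `profileIneqMinusQ_zero`,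
  `simple'_of_rk_one_two`, `SimpleRuleQ`, **`profileIneqMinusQ_of_simpleRuleQ`**,
  `profileIneq_of_simpleRuleQ`, `c025Profile_of_simpleRuleQ`, **`c025_of_simpleRuleQ`**.
-/

open scoped Matroid

namespace PercRepro.Cogirth

open Finset ThmH Skew Shadow Profile

variable {α : Type} [DecidableEq α] {K : Matroid α} [K.Finite]

/-- The co-rank-`q` row lifts over a loop: `ProfileIneqMinusQ (K ∖ ℓ) q u → ProfileIneqMinusQ K q u`. -/
theorem profileIneqMinusQ_of_loop_delete {ℓ : α} (hℓ : ℓ ∈ gr K) (h0 : rk K {ℓ} = 0) {q u : ℕ}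
    (hdel : ProfileIneqMinusQ (K ＼ ({ℓ} : Set α)) q u) : ProfileIneqMinusQ K q u := by
  unfold ProfileIneqMinusQ at hdel ⊢
  rw [sum_demand_loop hℓ h0, card_levelSetCoQ_loop hℓ h0]
  have : u.choose q * (2 * (levelSetCoQ (K ＼ ({ℓ} : Set α)) q u).card) =
      2 * (u.choose q * (levelSetCoQ (K ＼ ({ℓ} : Set α)) q u).card) := by ring
  omega

/-- **The row `q = 0` of every finite matroid** (induction on the loops; the loopless case is the basis count). -/
theorem profileIneqMinusQ_zero_aux (n : ℕ) :
    ∀ (K : Matroid α) [K.Finite], (gr K).card = n → ∀ u : ℕ, ProfileIneqMinusQ K 0 u := by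
  induction n using Nat.strong_induction_on with
  | _ n ih =>
    intro K _ hn u
    by_cases hl : ∃ ℓ ∈ gr K, rk K {ℓ} = 0
    · obtain ⟨ℓ, hℓ, h0⟩ := hl
      have hcard : (gr (K ＼ ({ℓ} : Set α))).card = n - 1 := by
        rw [gr_delete', card_erase_of_mem hℓ, hn]
      have hlt : n - 1 < n := by
        have := card_pos.2 ⟨ℓ, hℓ⟩
        omega
      exact profileIneqMinusQ_of_loop_delete hℓ h0 (ih (n - 1) hlt (K ＼ ({ℓ} : Set α)) hcard u)
    · push Not at hl
      have hR0 : Rq K 0 = {∅} := by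
        ext B
        rw [mem_Rq, mem_singleton]
        constructor
        · rintro ⟨hB, hr⟩
          by_contra hne
          obtain ⟨x, hx⟩ := nonempty_iff_ne_empty.2 hne
          have h1 : rk K {x} ≤ rk K B := rk_mono_sub (singleton_subset_iff.2 hx)
          have h2 : rk K B = 0 := by
            rw [← coe_rk] at hr
            exact_mod_cast hr
          have h3 := hl x (hB hx)
          omega
        · rintro rfl
          refine ⟨empty_subset _, ?_⟩
          rw [coe_empty, Matroid.eRk_empty]
          rfl
      unfold ProfileIneqMinusQ
      rw [hR0, sum_singleton, Nat.choose_zero_right, one_mul]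
      have hL : levelSetCoQ K 0 u = levelSet K u := by
        unfold levelSetCoQ
        exact filter_true_of_mem (fun _ _ => Nat.zero_le _)
      rw [hL]
      unfold demand
      rw [sdiff_empty]
      split_ifs with hu
      · have := choose_rk_le_card_levelSet K (u + 1)
        rw [Nat.add_sub_cancel] at this
        exact this
      · exact Nat.zero_le _

/-- The row `q = 0`. -/
theorem profileIneqMinusQ_zero (K : Matroid α) [K.Finite] (u : ℕ) : ProfileIneqMinusQ K 0 u :=
  profileIneqMinusQ_zero_aux _ K rfl u

/-- A loopless matroid without parallel pairs is simple (`Simple'`). -/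
theorem simple'_of_rk_one_two (h1 : ∀ x ∈ gr K, rk K {x} = 1)
    (h2 : ∀ x ∈ gr K, ∀ y ∈ gr K, x ≠ y → rk K {x, y} = 2) : Simple' K := by
  intro B hB hcard
  have hc : B.card = 0 ∨ B.card = 1 ∨ B.card = 2 := by omega
  rcases hc with hc | hc | hc
  · rw [card_eq_zero] at hc
    rw [hc, coe_empty]
    exact K.empty_indep
  · obtain ⟨x, rfl⟩ := card_eq_one.1 hc
    apply indep_of_rk_eq_card
    rw [card_singleton]
    exact h1 x (hB (mem_singleton_self x))
  · obtain ⟨x, y, hxy, rfl⟩ := card_eq_two.1 hc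
    apply indep_of_rk_eq_card
    rw [card_pair hxy]
    exact h2 x (hB (mem_insert_self _ _)) y (hB (mem_insert_of_mem (mem_singleton_self y))) hxy

/-- **The gap-monotonicity rule on SIMPLE matroids**: every simple matroid on at least `u + q + 1` elements has a
point `z` with `GapMonoQ N z q u`. -/
def SimpleRuleQ (α : Type) [DecidableEq α] : Prop :=
  ∀ (q u : ℕ), q < u → ∀ (N : Matroid α) [N.Finite], Simple' N → u + q + 1 ≤ (gr N).card →
    ∃ z ∈ gr N, GapMonoQ N z q u

/-- **THE REDUCTION**: the rule on simple matroids gives the co-rank-`q` row of every finite matroid, for every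
`q < u` (strong induction on `#E` for all `(q, u)` at once). -/
theorem profileIneqMinusQ_of_simpleRuleQ_aux (hrule : SimpleRuleQ α) (n : ℕ) :
    ∀ (K : Matroid α) [K.Finite], (gr K).card = n → ∀ q u : ℕ, q < u → ProfileIneqMinusQ K q u := by
  induction n using Nat.strong_induction_on with
  | _ n ih =>
    intro K _ hn q u hqu
    -- `q = 0`: the basis count
    rcases Nat.eq_zero_or_pos q with hq0 | hq
    · rw [hq0]
      exact profileIneqMinusQ_zero K u
    -- small ground sets
    by_cases hsmall : (gr K).card ≤ u + q
    · exact profileIneqMinusQ_of_card_le hqu.le hsmall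
    push Not at hsmall
    -- the row of `K ∖ z` for any `z ∈ E` is the induction hypothesis
    have hIH : ∀ z ∈ gr K, ProfileIneqMinusQ (K ＼ ({z} : Set α)) q u := by
      intro z hz
      have hcard : (gr (K ＼ ({z} : Set α))).card = n - 1 := by
        rw [gr_delete', card_erase_of_mem hz, hn]
      have hlt : n - 1 < n := by
        have := card_pos.2 ⟨z, hz⟩
        omega
      exact ih (n - 1) hlt _ hcard q u hqu
    -- a loop
    by_cases hl : ∃ ℓ ∈ gr K, rk K {ℓ} = 0
    · obtain ⟨ℓ, hℓ, h0⟩ := hl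
      exact profileIneqMinusQ_of_gapMonoQ (gapMonoQ_of_loop hℓ h0 (hIH ℓ hℓ)) (hIH ℓ hℓ)
    push Not at hl
    have h1 : ∀ x ∈ gr K, rk K {x} = 1 := by
      intro x hx
      have := rk_le_card (M := K) ({x} : Finset α)
      rw [card_singleton] at this
      have := hl x hx
      omega
    -- a parallel pair
    by_cases hp : ∃ z ∈ gr K, ∃ z' ∈ gr K, z ≠ z' ∧ rk K {z, z'} = 1
    · obtain ⟨z, hz, z', hz', hzz', hpar⟩ := hp
      have hcard : (gr ((K ＼ ({z} : Set α)) ／ ({z'} : Set α))).card = n - 2 := by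
        rw [gr_contract', gr_delete', card_erase_of_mem (mem_erase.2 ⟨Ne.symm hzz', hz'⟩), card_erase_of_mem hz, hn]
        omega
      have hlt : n - 2 < n := by
        have := card_pos.2 ⟨z, hz⟩
        omega
      have hdel := ih (n - 2) hlt _ hcard (q - 1) (u - 1) (by omega)
      exact profileIneqMinusQ_of_gapMonoQ
        (gapMonoQ_of_parallel hz hz' hzz' (h1 z hz) (h1 z' hz') hpar hq hqu hdel) (hIH z hz)
    push Not at hp
    have h2 : ∀ x ∈ gr K, ∀ y ∈ gr K, x ≠ y → rk K {x, y} = 2 := by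
      intro x hx y hy hxy
      have hle := rk_le_card (M := K) ({x, y} : Finset α)
      rw [card_pair hxy] at hle
      have hge : rk K {x} ≤ rk K {x, y} := rk_mono_sub (by simp)
      have hne := hp x hx y hy hxy
      have := h1 x hx
      omega
    -- simple: the rule
    obtain ⟨z, hz, hgm⟩ := hrule q u hqu K (simple'_of_rk_one_two h1 h2) (by omega)
    exact profileIneqMinusQ_of_gapMonoQ hgm (hIH z hz)

/-- The co-rank-`q` row of every finite matroid from the rule on simple matroids. -/
theorem profileIneqMinusQ_of_simpleRuleQ (hrule : SimpleRuleQ α) (K : Matroid α) [K.Finite] {q u : ℕ}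
    (hqu : q < u) : ProfileIneqMinusQ K q u :=
  profileIneqMinusQ_of_simpleRuleQ_aux hrule _ K rfl q u hqu

/-- The plain row from the rule on simple matroids. -/
theorem profileIneq_of_simpleRuleQ (hrule : SimpleRuleQ α) (K : Matroid α) [K.Finite] {q u : ℕ}
    (hqu : q < u) : ProfileIneq K q u :=
  profileIneq_of_minusQ hqu.le (profileIneqMinusQ_of_simpleRuleQ hrule K hqu)

end PercRepro.Cogirth

namespace PercRepro

/-- **`C025Profile` FROM THE GAP-MONOTONICITY RULE ON SIMPLE MATROIDS.** -/
theorem c025Profile_of_simpleRuleQ (h : ∀ (α : Type) [DecidableEq α], Cogirth.SimpleRuleQ α) : C025Profile := by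
  intro α _ M _ q u hqu
  exact Cogirth.profileIneq_of_simpleRuleQ (h α) M hqu

/-- **`C025` ITSELF FROM THE GAP-MONOTONICITY RULE ON SIMPLE MATROIDS** (through the tree's bridge
`c025_of_profile`). -/
theorem c025_of_simpleRuleQ (h : ∀ (α : Type) [DecidableEq α], Cogirth.SimpleRuleQ α) : C025 :=
  c025_of_profile (c025Profile_of_simpleRuleQ h)

end PercRepro
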